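import Summits.NavierStokesRegularity.NavierStokesRegularity.Theses.TypeICertificateLadder
import Literature.Barriers.NavierStokesRegularity.NavierStokesInequalitySingularSolutionHolds
import Literature.Barriers.NavierStokesRegularity.SchefferSwitchedSolution
import Literature.Barriers.NavierStokesRegularity.SchefferSwitchedSingular
import Literature.Barriers.NavierStokesRegularity.SchefferSwitchedIntegrability
import Literature.Barriers.NavierStokesRegularity.SchefferSwitchedField

/-!
# Crux `Target` = `TypeICertificateLadder.NoTypeIBlowup` (stmt-NavierStokesRegularity-1217), negative side:
# the Navier–Stokes-INEQUALITY analogue of the crux is false (Scheffer 1985, at the Type-I rate)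

Negative-side (cdisprove, D-0016) model refutation extracted from the crux work file
`Cruxes/Target/Disproof.lean` §7 (gen 3), importable. The crux: a classical solution of unforced
NS on `ℝ³ × [0, T)`, Leray–Hopf on `[0, T]` from the rapidly decaying datum `u 0`, with the Type-I
rate `‖u(t, x)‖ ≤ C/√(T - t)` as `t ↑ T`, extends classically past `T`.

* `isTypeIBlowup_glue` — NEW: Scheffer's switched field `𝔲 = glue T τ z u` of a classical NSI
  block (tree `IsNSIBlock`, `Scheffer.glue`) blows up at its singular time `T₀ = T/(1 - τ²)`
  exactly at the TYPE-I RATE: `√(T₀ - t) ‖𝔲(t, x)‖ ≤ M √T₀` (magnitude `τ^{-j}` on the `j`-th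
  piece, remaining life span `τ^{2j} T₀`).
* `target_nsiAnalogue_false` — hence the NSI analogue of the crux (weak NSI solution in the energy
  class with the local energy inequality, `C^∞` compactly supported slices at all times, rapidly
  decaying datum, Type-I rate; conclusion weakened to "every `(T, x)` regular") is FALSE, by the
  tree's sorry-free discharge of Scheffer's theorem (`NSIBlockExists_holds`,
  `isWeakNSISolution_glue`, `not_isRegularPoint_glue`); `exists_nsi_typeI_singular` packages the
  witness. LESSON: finite energy + local energy inequality + Type-I rate + smooth slices do NOT
  force regularity — a proof of the crux must use the EQUATION `f = 0` (vorticity equation,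
  backward uniqueness, unique continuation, the exact Leray profile equation) or the
  time-regularity of classical solutions on `[0, T)`; CKN-type ε-regularity, valid verbatim for NSI
  solutions (Ożański 2020, p. 3), cannot distinguish.

Nothing here closes the item (`--supports`).
[cite: Scheffer1985, Thm. 1.1] [cite: Ozanski2019NSI, Thm. 1.5 and p. 3]
-/

noncomputable section

open MeasureTheory TopologicalSpace Set Function Filter Metric
open scoped Topology RealInnerProductSpace ContDiff Laplacian InnerProductSpace
open Literature.Analysis.FluidPDE Literature.Barriers.NavierStokesRegularity
open Literature.Barriers.NavierStokesRegularity.Scheffer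

namespace Summit.NavierStokesRegularity.NavierStokesRegularity.Theorems.Target.Negative

/-- Local notation for physical space `ℝ³ = EuclideanSpace ℝ (Fin 3)`. -/
local notation "ℝ³" => EuclideanSpace ℝ (Fin 3)

section NSI

variable {T ν₀ τ : ℝ} {z : ℝ³} {G : Set ℝ³} {u : ℝ → ℝ³ → ℝ³}

/-- **Scheffer's switched field blows up at the Type-I rate.** On the `j`-th piece
`[t_j, t_{j+1})` the glued field is `τ^{-j} u(s, y)` with `‖u‖ ≤ M` on `[0, T] × ℝ³`, while the
remaining life span is `T₀ - t ≤ T₀ - t_j = τ^{2j} T₀`; hence `√(T₀ - t) ‖𝔲(t, x)‖ ≤ M √T₀` for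
every `t < T₀` and every `x` (the field vanishes for `t < 0`): the rate clause `IsTypeIBlowup`
of the crux holds at Scheffer's singular time with constant `M √T₀`. -/
theorem isTypeIBlowup_glue (h : IsNSIBlock T ν₀ τ z G u) :
    IsTypeIBlowup (glue T τ z u) (blowupTime T τ) := by
  obtain ⟨M, hM0, hM⟩ := h.exists_bound_norm
  refine ⟨M * Real.sqrt (blowupTime T τ), ?_⟩
  filter_upwards [self_mem_nhdsWithin] with t ht x
  have htT : t < blowupTime T τ := ht
  have hpos : 0 < blowupTime T τ - t := sub_pos.2 htT
  have hsq : 0 < Real.sqrt (blowupTime T τ - t) := Real.sqrt_pos.2 hpos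
  have hT₀ : 0 ≤ Real.sqrt (blowupTime T τ) := Real.sqrt_nonneg _
  rw [le_div_iff₀ hsq]
  rcases lt_or_ge t 0 with hneg | ht0
  · rw [glue_eq_zero_of_neg h.T_pos h.τ_pos z u hneg]
    simp only [Pi.zero_apply, norm_zero, zero_mul]
    positivity
  · obtain ⟨j, hj⟩ := exists_mem_Ico_switchTime h.τ_pos h.τ_lt_one ht0 htT
    have hτj : 0 < (τ⁻¹) ^ j := pow_pos (inv_pos.2 h.τ_pos) j
    have hτj' : 0 < τ ^ j := pow_pos h.τ_pos j
    rw [glue_apply_of_mem_Ico h.T_pos h.τ_pos z u hj, norm_smul, Real.norm_eq_abs, abs_of_pos hτj]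
    have hs := localTime_mem_Ico (T := T) h.τ_pos hj
    have hb := hM _ (Ico_subset_Icc_self hs)
      ((1 - τ)⁻¹ • z + (τ⁻¹) ^ j • (x - (1 - τ)⁻¹ • z))
    -- the remaining life span
    have hne : τ ^ 2 ≠ 1 := (pow_lt_one₀ h.τ_pos.le h.τ_lt_one two_ne_zero).ne
    have hrem : blowupTime T τ - t ≤ τ ^ (2 * j) * blowupTime T τ := by
      have e := blowupTime_sub_switchTime T hne j
      linarith [hj.1]
    have hsqrt : Real.sqrt (blowupTime T τ - t) ≤ τ ^ j * Real.sqrt (blowupTime T τ) := by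
      calc Real.sqrt (blowupTime T τ - t) ≤ Real.sqrt (τ ^ (2 * j) * blowupTime T τ) :=
            Real.sqrt_le_sqrt hrem
        _ = τ ^ j * Real.sqrt (blowupTime T τ) := by
            rw [pow_mul, Real.sqrt_mul (pow_nonneg (sq_nonneg τ) j), ← pow_mul, mul_comm 2 j,
              pow_mul, Real.sqrt_sq hτj'.le]
    calc (τ⁻¹) ^ j * ‖u ((τ⁻¹) ^ (2 * j) * (t - switchTime T τ j))
            ((1 - τ)⁻¹ • z + (τ⁻¹) ^ j • (x - (1 - τ)⁻¹ • z))‖ * Real.sqrt (blowupTime T τ - t)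
        ≤ (τ⁻¹) ^ j * M * (τ ^ j * Real.sqrt (blowupTime T τ)) := by
          have h1 : (τ⁻¹) ^ j * ‖u ((τ⁻¹) ^ (2 * j) * (t - switchTime T τ j))
              ((1 - τ)⁻¹ • z + (τ⁻¹) ^ j • (x - (1 - τ)⁻¹ • z))‖ ≤ (τ⁻¹) ^ j * M :=
            mul_le_mul_of_nonneg_left hb hτj.le
          exact mul_le_mul h1 hsqrt hsq.le (by positivity)
      _ = M * Real.sqrt (blowupTime T τ) := by
          rw [inv_pow]
          field_simp

/-- A smooth compactly supported field decays rapidly (each `Dⁿu₀` is continuous with compact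
support, so `(1 + |x|)^K |Dⁿu₀(x)|` is bounded). [folklore] -/
theorem hasRapidSpatialDecay_of_hasCompactSupport {u₀ : ℝ³ → ℝ³} (hsm : ContDiff ℝ ∞ u₀)
    (hc : HasCompactSupport u₀) : HasRapidSpatialDecay u₀ := by
  intro n K
  have hcont : Continuous fun x => (1 + ‖x‖) ^ K * ‖iteratedFDeriv ℝ n u₀ x‖ :=
    ((continuous_const.add continuous_norm).pow K).mul
      (hsm.continuous_iteratedFDeriv (m := n) (mod_cast le_top)).norm
  have hsupp : HasCompactSupport fun x => (1 + ‖x‖) ^ K * ‖iteratedFDeriv ℝ n u₀ x‖ :=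
    ((hc.iteratedFDeriv n).norm).mul_left
  obtain ⟨C, hC⟩ := hcont.bounded_above_of_compact_support hsupp
  refine ⟨C, fun x => ?_⟩
  have h := hC x
  rwa [Real.norm_eq_abs, abs_of_nonneg (by positivity)] at h

/-- The glued field starts from the (smooth, compactly supported) initial slice of the block,
hence from a rapidly decaying datum. -/
theorem hasRapidSpatialDecay_glue_zero (h : IsNSIBlock T ν₀ τ z G u) :
    HasRapidSpatialDecay (glue T τ z u 0) :=
  hasRapidSpatialDecay_of_hasCompactSupport (h.contDiff_glue_slice 0)
    (h.isCompact.of_isClosed_subset (isClosed_tsupport _) (h.tsupport_glue_slice_subset 0))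

/-- Every slice of the glued field is smooth with compact support (in `G`). -/
theorem contDiff_hasCompactSupport_glue (h : IsNSIBlock T ν₀ τ z G u) (t : ℝ) :
    ContDiff ℝ ∞ (glue T τ z u t) ∧ HasCompactSupport (glue T τ z u t) :=
  ⟨h.contDiff_glue_slice t,
    h.isCompact.of_isClosed_subset (isClosed_tsupport _) (h.tsupport_glue_slice_subset t)⟩

/-- **Model refutation: the Navier–Stokes-INEQUALITY analogue of the crux is FALSE.** The negated
statement replaces "classical solution of NS on `[0, T)`, Leray–Hopf on `[0, T]`" by "weak
solution of the Navier–Stokes inequality on `ℝ³ × (0, ∞)`" (tree `IsWeakNSISolution`, Ożański 2020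
Def. 1.1: energy class, `∇u ∈ L²`, solenoidal, pressure formula, local energy inequality — formally
`∂ₜu - νΔu + (u·∇)u + ∇p = f`, `f·u ≤ 0`) with `C^∞` compactly supported slices at all `t ≥ 0`,
keeps the rapidly decaying datum and the Type-I rate at `T`, and WEAKENS the conclusion to "every
`(T, x)` is a regular point".
Proof (Scheffer 1985, Thm. 1.1, in the
tree's sorry-free discharge `NSIBlockExists_holds` + `isWeakNSISolution_glue` +
`not_isRegularPoint_glue`, sharpened by `isTypeIBlowup_glue`): Scheffer's switched field is a
finite-energy weak solution of the Navier–Stokes inequality with smooth compactly supported slices,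
from a smooth compactly supported datum, which blows up at `T₀ = T/(1 - τ²)` at the TYPE-I RATE and
is singular at `(T₀, x₀)`. So the energy class, incompressibility, the pressure formula, the local
energy inequality and the Type-I rate together do NOT give regularity: any proof of the crux must
use the Navier–Stokes EQUATION (`f = 0`) — e.g. the vorticity equation, backward uniqueness,
unique continuation, Liouville theorems for the exact profile equation — or the time-regularity
of classical solutions across `[0, T)` (Scheffer's field jumps down in magnitude at the switching
times `t_j ↑ T₀`), not merely energy-inequality technology (CKN-type ε-regularity holds verbatim for
NSI solutions, Ożański 2020 p. 3, and cannot see the difference). -/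
theorem target_nsiAnalogue_false :
    ¬ (∀ (ν T : ℝ), 0 < ν → 0 < T → ∀ (u : ℝ → ℝ³ → ℝ³) (p : ℝ → ℝ³ → ℝ),
        IsWeakNSISolution ν u p →
        (∀ t : ℝ, 0 ≤ t → ContDiff ℝ ∞ (u t) ∧ HasCompactSupport (u t)) →
        HasRapidSpatialDecay (u 0) → IsTypeIBlowup u T → ∀ x : ℝ³, IsRegularPoint u (T, x)) := by
  intro hN
  obtain ⟨T, ν₀, τ, z, G, u, h⟩ := NSIBlockExists_holds
  have hreg := hN ν₀ (blowupTime T τ) h.ν₀_pos h.blowupTime_pos (glue T τ z u)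
    (fun s => normalisedPressure (glue T τ z u s))
    (h.isWeakNSISolution_glue ⟨h.ν₀_pos.le, le_rfl⟩)
    (fun t _ => contDiff_hasCompactSupport_glue h t) (hasRapidSpatialDecay_glue_zero h)
    (isTypeIBlowup_glue h) (blowupPoint τ z)
  exact h.not_isRegularPoint_glue hreg

/-- The same, packaged as an existence statement over the crux's own clauses: **there is a
finite-energy weak NSI solution, smooth and compactly supported at every time, from a rapidly
decaying datum, with a Type-I-rate singular point** (`ν > 0`, `T > 0`). -/
theorem exists_nsi_typeI_singular :
    ∃ (ν T : ℝ) (u : ℝ → ℝ³ → ℝ³) (p : ℝ → ℝ³ → ℝ) (x₀ : ℝ³), 0 < ν ∧ 0 < T ∧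
      IsWeakNSISolution ν u p ∧ (∀ t : ℝ, ContDiff ℝ ∞ (u t) ∧ HasCompactSupport (u t)) ∧
      HasRapidSpatialDecay (u 0) ∧ IsTypeIBlowup u T ∧ ¬ IsRegularPoint u (T, x₀) := by
  obtain ⟨T, ν₀, τ, z, G, u, h⟩ := NSIBlockExists_holds
  exact ⟨ν₀, blowupTime T τ, glue T τ z u, fun s => normalisedPressure (glue T τ z u s),
    blowupPoint τ z, h.ν₀_pos, h.blowupTime_pos, h.isWeakNSISolution_glue ⟨h.ν₀_pos.le, le_rfl⟩,
    fun t => contDiff_hasCompactSupport_glue h t, hasRapidSpatialDecay_glue_zero h,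
    isTypeIBlowup_glue h, h.not_isRegularPoint_glue⟩

end NSI

end Summit.NavierStokesRegularity.NavierStokesRegularity.Theorems.Target.Negative

end
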